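import Literature.Algebra.EuclideanLattices.RegevRoutineFinal
import HarnessLib

/-!
# Regev's per-copy routine as a circuit family, VI: the coins of a branch

Sixth file of the circuit-level construction towards the discharge of
`Literature.Algebra.EuclideanLattices.usvp_of_dihedralCoset` (O. Regev, *Quantum computation and
lattice problems*, SIAM J. Comput. 33 (2004), Thm. 1.1; the routine of the proof of Lemma 3.12,
p. 14). The branches of the Hadamard layer (`IsBranch`, file V) are parametrised by their
**coins** — the guess pattern on the guess zone and, for every coin zone `k < rmax`, a zone
pattern (the `ix` field with the control bit, and the `4n` data bits of each of the `n` digit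
fields) — so that the counting arguments of Lemma 3.12 (uniform `t, ā` and grid point per
register, independence over the registers) become statements about the product type
`Coins = GPat × (Fin rmax → ZPat)`:

* `GPat`, `ZPat`, `Coins`; `zoneFn` (the content of a coin zone with a given pattern),
  `branchW`/`branchOf` (the branch with given coins), `coinsOf` (reading the coins off an
  assignment), with `coinsOf_branchW`, **`branchOf_coinsOf`** (a branch is the branch of its coins)
  and `isBranch_branchOf`: coins and branches correspond bijectively (`branchOf_injective`);
* `card_Coins`, `numCoins_eq` — `|Coins| = 2^{numCoins}`;
* **`stateQ_eq_coins`** — the state after the compiled program is `2^{-numCoins/2}` on the image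
  of `c ↦ kappa (branchOf c)` and `0` elsewhere (the form consumed by `DCPMixture.bornSum_ge`);
* `liftW_branchOf`, `guessOf_branchW`, `ixcOf_branchW`, `tacOf_branchW` — the data entering the
  closed-form final state `finSt` of file V, read off the coins.

No named fact is introduced.

## References

* O. Regev, *Quantum computation and lattice problems*, SIAM J. Comput. 33 (2004) 738–760, proof
  of Lemma 3.12 (p. 14) [Regev2004].
* M. A. Nielsen, I. L. Chuang, *Quantum Computation and Quantum Information*, CUP 2010, §1.4.4
  (`H^{⊗c}|0⟩` is the uniform superposition over `{0,1}^c`) [NielsenChuang2010].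
-/

noncomputable section

namespace Literature.Algebra.EuclideanLattices

namespace RegevRoutine

open _root_.Computability Literature.Computability.Complexity Literature.Computability.Cryptography
  Literature.Computability.QuantumComplexity Literature.Computability.QuantumComplexity.ZoneGadgets
  Turing RevSim RevClean RevMux Matrix

variable {P : Params}

/-! ### Coin patterns -/

/-- A guess pattern: the content of the guess zone. [cite: Regev2004, Thm. 1.1 (proof, p. 7: the guesses)] -/
abbrev GPat (P : Params) (L : ℕ) : Type := Fin (gam P L) → Bool

/-- A zone pattern: the `ix` field together with the control bit `t`, and the `4n` data bits of
each of the `n` digit fields of `ā`. [cite: Regev2004, Lemma 3.12 (proof, p. 14: t ∈ {0,1}, ā ∈ {0,…,M−1}ⁿ, the grid point)] -/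
abbrev ZPat (P : Params) (L n : ℕ) : Type := (Fin (kap P L + 1) → Bool) × (Fin n → Fin (4 * n) → Bool)

/-- The coins of a branch: a guess pattern and a zone pattern for every coin zone. [folklore] -/
abbrev Coins (P : Params) (L n : ℕ) : Type := GPat P L × (Fin (rmax P L) → ZPat P L n)

/-- **The content of a coin zone with pattern `p`** at local index `t`: the `ix`/control field,
then digit field `i`, bit `b` at `kap + 1 + i (4n+1) + b` (`b < 4n`; the separators and the tail
are `0`). [folklore] -/
def zoneFn (P : Params) (L n : ℕ) (p : ZPat P L n) (t : ℕ) : Bool :=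
  if h : t < kap P L + 1 then p.1 ⟨t, h⟩
  else if h' : (t - (kap P L + 1)) / (4 * n + 1) < n ∧ (t - (kap P L + 1)) % (4 * n + 1) < 4 * n then
    p.2 ⟨_, h'.1⟩ ⟨_, h'.2⟩
  else false

/-- The guess pattern extended by `0`. [folklore] -/
def gExt (P : Params) (L : ℕ) (g : GPat P L) : ℕ → Bool := fun t => if h : t < gam P L then g ⟨t, h⟩ else false

section ZoneFn

variable {L n : ℕ} (p : ZPat P L n)

/-- `zoneFn` on the `ix`/control field. [folklore] -/
theorem zoneFn_lo {t : ℕ} (ht : t < kap P L + 1) : zoneFn P L n p t = p.1 ⟨t, ht⟩ := by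
  unfold zoneFn; rw [dif_pos ht]

/-- `zoneFn` on a data bit of a digit field. [folklore] -/
theorem zoneFn_digit (i : Fin n) (b : Fin (4 * n)) : zoneFn P L n p (kap P L + 1 + i * (4 * n + 1) + b) = p.2 i b := by
  have hb := b.isLt
  have h1 : ¬ kap P L + 1 + i * (4 * n + 1) + b < kap P L + 1 := by omega
  have e : kap P L + 1 + i * (4 * n + 1) + b - (kap P L + 1) = b + i * (4 * n + 1) := by omega
  have hd : ((b : ℕ) + (i : ℕ) * (4 * n + 1)) / (4 * n + 1) = i := by
    rw [Nat.add_mul_div_right _ _ (by omega), Nat.div_eq_of_lt (by omega), Nat.zero_add]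
  have hm : ((b : ℕ) + (i : ℕ) * (4 * n + 1)) % (4 * n + 1) = b := by
    rw [Nat.add_mul_mod_self_right, Nat.mod_eq_of_lt (by omega)]
  unfold zoneFn
  rw [dif_neg h1]
  simp only [e, hd, hm, Fin.eta]
  rw [dif_pos ⟨i.isLt, hb⟩]

/-- The coin offsets inside a zone. [folklore] -/
def IsCoinOff (P : Params) (L n t : ℕ) : Prop :=
  t < kap P L + 1 ∨ ∃ i, i < n ∧ ∃ b, b < 4 * n ∧ t = kap P L + 1 + i * (4 * n + 1) + b

/-- `zoneFn` vanishes off the coin offsets. [folklore] -/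
theorem zoneFn_eq_false {t : ℕ} (ht : ¬ IsCoinOff P L n t) : zoneFn P L n p t = false := by
  unfold zoneFn
  have h1 : ¬ t < kap P L + 1 := fun h => ht (Or.inl h)
  rw [dif_neg h1, dif_neg]
  rintro ⟨hi, hb⟩
  refine ht (Or.inr ⟨_, hi, _, hb, ?_⟩)
  have := Nat.div_add_mod' (t - (kap P L + 1)) (4 * n + 1)
  omega

/-- A wire of zone `k` is a coin wire of zone `k` iff its offset is a coin offset. [folklore] -/
theorem mem_coinPosZone_iff_isCoinOff {k t : ℕ} : oC P L k + t ∈ coinPosZone P L n k ↔ IsCoinOff P L n t := by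
  rw [mem_coinPosZone]
  unfold IsCoinOff
  constructor
  · rintro (⟨j, hj, he⟩ | ⟨i, hi, b, hb, he⟩)
    · exact Or.inl (by omega)
    · exact Or.inr ⟨i, hi, b, hb, by omega⟩
  · rintro (hj | ⟨i, hi, b, hb, rfl⟩)
    · exact Or.inl ⟨t, hj, rfl⟩
    · exact Or.inr ⟨i, hi, b, hb, by omega⟩

/-- Coin offsets are below `kap + slotW n ≤ cW`. [folklore] -/
theorem IsCoinOff.lt {t : ℕ} (h : IsCoinOff P L n t) : t < kap P L + slotW n := by
  rcases h with h | ⟨i, hi, b, hb, rfl⟩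
  · unfold slotW; omega
  · have := digit_lt_slotW hi hb; omega

end ZoneFn

/-! ### The branch with given coins -/

/-- **The assignment with coins `c`** on the input `x` (as an `ℕ`-indexed assignment): the input
on `[0, L)`, the guess pattern on the guess zone, the zone patterns on the coin zones, `0`
elsewhere. [folklore] -/
def branchW (P : Params) (L n : ℕ) (x : List Bool) (c : Coins P L n) : ℕ → Bool := fun i =>
  if i < L then x.getD i false
  else if h : oGz P L ≤ i ∧ i < oGz P L + gam P L then c.1 ⟨i - oGz P L, by omega⟩
  else if h' : cBase P L ≤ i ∧ (i - cBase P L) / cW P L < rmax P L then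
    zoneFn P L n (c.2 ⟨_, h'.2⟩) ((i - cBase P L) % cW P L)
  else false

/-- **The coins of an assignment.** [folklore] -/
def coinsOf (P : Params) (L n : ℕ) (w : ℕ → Bool) : Coins P L n :=
  (fun t => w (oGz P L + t), fun k => (fun j => w (oC P L k + j), fun i b => w (oC P L k + (kap P L + 1) + i * (4 * n + 1) + b)))

section Branch

variable {L n : ℕ} {x : List Bool} (c : Coins P L n)

/-- The width of a coin zone is positive. [folklore] -/
theorem cW_pos (L : ℕ) : 0 < cW P L := by unfold cW sig slotW; omega

/-- `branchW` on the input wires. [folklore] -/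
theorem branchW_lt {i : ℕ} (hi : i < L) : branchW P L n x c i = x.getD i false := by
  unfold branchW; rw [if_pos hi]

/-- `branchW` on the guess zone. [folklore] -/
theorem branchW_gz (t : Fin (gam P L)) : branchW P L n x c (oGz P L + t) = c.1 t := by
  have hc := offsets_chain (P := P) L
  have ht := t.isLt
  unfold branchW
  rw [if_neg (by omega), dif_pos ⟨by omega, by omega⟩]
  simp only [Nat.add_sub_cancel_left, Fin.eta]

/-- `branchW` on coin zone `k`. [folklore] -/
theorem branchW_cz (k : Fin (rmax P L)) {t : ℕ} (ht : t < cW P L) : branchW P L n x c (oC P L k + t) = zoneFn P L n (c.2 k) t := by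
  have hc := offsets_chain (P := P) L
  have hk := k.isLt
  obtain ⟨hq, hr⟩ := zone_divMod (base := cBase P L) (w := cW P L) (k := k) (i := oC P L k + t) ht rfl
  have hCb := cBase_le_oC (P := P) L k
  unfold branchW
  rw [if_neg (by omega), dif_neg (fun h => by omega), dif_pos ⟨by omega, by rw [hq]; exact hk⟩]
  simp only [hq, hr, Fin.eta]

/-- `branchW` vanishes elsewhere. [folklore] -/
theorem branchW_other {i : ℕ} (h1 : L ≤ i) (h2 : ¬ (oGz P L ≤ i ∧ i < oGz P L + gam P L)) (h3 : ¬ (cBase P L ≤ i ∧ i < gBase P L)) :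
    branchW P L n x c i = false := by
  have hc := offsets_chain (P := P) L
  unfold branchW
  rw [if_neg (by omega), dif_neg h2, dif_neg]
  rintro ⟨h4, h5⟩
  refine h3 ⟨h4, ?_⟩
  have : ((i - cBase P L) / cW P L + 1) * cW P L ≤ rmax P L * cW P L := Nat.mul_le_mul_right _ h5
  have h6 := Nat.lt_div_mul_add (a := i - cBase P L) (cW_pos (P := P) L)
  rw [Nat.add_mul, Nat.one_mul] at this
  unfold gBase; omega

/-- `branchW` vanishes from `gBase` on (in particular from `Wtot` on). [folklore] -/
theorem branchW_of_gBase_le {i : ℕ} (hi : gBase P L ≤ i) : branchW P L n x c i = false := by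
  have hc := offsets_chain (P := P) L
  exact branchW_other c (by omega) (fun h => by omega) (fun h => by omega)

/-- **Reading the coins back.** [folklore] -/
theorem coinsOf_branchW (hn : n ≤ L) : coinsOf P L n (branchW P L n x c) = c := by
  have hsw : slotW n ≤ sig L := by unfold sig slotW; have := ell_mono hn; omega
  have hcw : cW P L = kap P L + sig L := rfl
  refine Prod.ext (funext fun t => branchW_gz c t) (funext fun k => Prod.ext (funext fun j => ?_) (funext fun i => funext fun b => ?_))
  · change branchW P L n x c (oC P L k + j) = (c.2 k).1 j
    have := j.isLt
    rw [branchW_cz c k (by unfold slotW at hsw; omega), zoneFn_lo _ j.isLt]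
  · change branchW P L n x c (oC P L k + (kap P L + 1) + i * (4 * n + 1) + b) = (c.2 k).2 i b
    have hlt := digit_lt_slotW i.isLt b.isLt
    rw [show oC P L k + (kap P L + 1) + i * (4 * n + 1) + b = oC P L k + (kap P L + 1 + i * (4 * n + 1) + b) by omega,
      branchW_cz c k (by omega), zoneFn_digit]

/-- `branchW` is injective in the coins. [folklore] -/
theorem branchW_injective (hn : n ≤ L) : Function.Injective (branchW P L n x : Coins P L n → ℕ → Bool) := fun c c' h => by
  rw [← coinsOf_branchW c hn, ← coinsOf_branchW c' hn, h]

end Branch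

/-! ### Coins and branches of the Hadamard layer -/

section HBranch

variable {x : List Bool}

/-- **The branch with coins `c`** (a basis label of the register of the routine on `x`). [folklore] -/
def branchOf (P : Params) (x : List Bool) (c : Coins P x.length (nOf x.length)) : QReg (x.length + anc P x.length) :=
  fun i => branchW P x.length (nOf x.length) x c i

/-- `branchOf`, lifted to `ℕ`-indexed wires, is `branchW`. [folklore] -/
theorem liftW_branchOf (c : Coins P x.length (nOf x.length)) : liftW (branchOf P x c) = branchW P x.length (nOf x.length) x c := by
  funext i
  by_cases hi : i < x.length + anc P x.length
  · simp [liftW, hi, branchOf]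
  · have hc := offsets_chain (P := P) x.length
    rw [add_anc] at hi
    simp only [liftW, add_anc, hi, dif_neg, not_false_eq_true]
    exact (branchW_of_gBase_le c (by omega)).symm

/-- The padded input, read at a wire. [folklore] -/
theorem padInput_apply (x : List Bool) (i : Fin (x.length + anc P x.length)) :
    padInput x.get (anc P x.length) i = x.getD i false := by
  have := congrFun (CWrap.liftW_padInput_get x (anc P x.length)) i
  rwa [liftW_val] at this

/-- **The assignment with coins `c` is a branch.** [folklore] -/
theorem isBranch_branchOf (c : Coins P x.length (nOf x.length)) : IsBranch P x (branchOf P x c) := by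
  intro j hj
  rw [mem_coinFin_iff] at hj
  rw [padInput_apply]
  change branchW P x.length (nOf x.length) x c j = _
  have hc := offsets_chain (P := P) x.length
  by_cases h1 : (j : ℕ) < x.length
  · exact branchW_lt c h1
  rw [List.getD_eq_default _ _ (not_lt.1 h1)]
  by_cases h2 : oGz P x.length ≤ j ∧ (j : ℕ) < oGz P x.length + gam P x.length
  · exfalso; refine hj ?_
    unfold coinPos
    exact List.mem_append_right _ (List.mem_map.2 ⟨j - oGz P x.length, List.mem_range.2 (by omega), by omega⟩)
  by_cases h3 : cBase P x.length ≤ j ∧ (j : ℕ) < gBase P x.length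
  · obtain ⟨heq, hlt⟩ := zone_eq_divMod (base := cBase P x.length) (w := cW P x.length) (i := j) (cW_pos x.length) h3.1
    have hk : (j - cBase P x.length) / cW P x.length < rmax P x.length := by
      by_contra hge
      have hm : rmax P x.length * cW P x.length ≤ (j - cBase P x.length) / cW P x.length * cW P x.length :=
        Nat.mul_le_mul_right _ (not_lt.1 hge)
      omega
    set k := (j - cBase P x.length) / cW P x.length with hkdef
    set t := (j - cBase P x.length) % cW P x.length with htdef
    have e : (j : ℕ) = oC P x.length k + t := by unfold oC; omega
    rw [e, branchW_cz c ⟨k, hk⟩ hlt]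
    refine zoneFn_eq_false _ fun hoff => hj ?_
    unfold coinPos
    refine List.mem_append_left _ (List.mem_flatMap.2 ⟨k, List.mem_range.2 hk, ?_⟩)
    rw [e]
    exact mem_coinPosZone_iff_isCoinOff.2 hoff
  · exact branchW_other c (not_lt.1 h1) h2 h3

/-- **A branch is the branch of its coins.** [folklore] -/
theorem branchOf_coinsOf {z : QReg (x.length + anc P x.length)} (hz : IsBranch P x z) :
    branchOf P x (coinsOf P x.length (nOf x.length) (liftW z)) = z := by
  have hc := offsets_chain (P := P) x.length
  have hn := nOf_le x.length
  have hsw : slotW (nOf x.length) ≤ sig x.length := by unfold sig slotW; have := ell_mono hn; omega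
  have hcw : cW P x.length = kap P x.length + sig x.length := rfl
  funext j
  change branchW P x.length (nOf x.length) x (coinsOf P x.length (nOf x.length) (liftW z)) j = z j
  -- off the coin wires `z` is the padded input
  have hpad : (j : ℕ) ∉ coinPos P x.length (nOf x.length) → z j = x.getD j false := fun hj => by
    rw [hz j (fun h => hj ((mem_coinFin_iff j).1 h)), padInput_apply]
  by_cases h1 : (j : ℕ) < x.length
  · rw [branchW_lt _ h1, hpad (fun h => by have := (coinPos_bounds hn h).1; omega)]
  by_cases h2 : oGz P x.length ≤ j ∧ (j : ℕ) < oGz P x.length + gam P x.length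
  · have e : (j : ℕ) = oGz P x.length + ((⟨j - oGz P x.length, by omega⟩ : Fin (gam P x.length)) : ℕ) := by simp; omega
    conv_lhs => rw [show branchW P x.length (nOf x.length) x (coinsOf P x.length (nOf x.length) (liftW z)) j =
      branchW P x.length (nOf x.length) x (coinsOf P x.length (nOf x.length) (liftW z)) (oGz P x.length + ((⟨j - oGz P x.length, by omega⟩ : Fin (gam P x.length)) : ℕ)) from by rw [← e]]
    rw [branchW_gz]
    change liftW z (oGz P x.length + (j - oGz P x.length)) = z j
    rw [show oGz P x.length + (j - oGz P x.length) = j by omega, liftW_val]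
  by_cases h3 : cBase P x.length ≤ j ∧ (j : ℕ) < gBase P x.length
  · obtain ⟨heq, hlt⟩ := zone_eq_divMod (base := cBase P x.length) (w := cW P x.length) (i := j) (cW_pos x.length) h3.1
    have hk : (j - cBase P x.length) / cW P x.length < rmax P x.length := by
      by_contra hge
      have hm : rmax P x.length * cW P x.length ≤ (j - cBase P x.length) / cW P x.length * cW P x.length :=
        Nat.mul_le_mul_right _ (not_lt.1 hge)
      omega
    set k := (j - cBase P x.length) / cW P x.length with hkdef
    set t := (j - cBase P x.length) % cW P x.length with htdef
    have e : (j : ℕ) = oC P x.length k + t := by unfold oC; omega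
    conv_lhs => rw [show branchW P x.length (nOf x.length) x (coinsOf P x.length (nOf x.length) (liftW z)) j =
      branchW P x.length (nOf x.length) x (coinsOf P x.length (nOf x.length) (liftW z)) (oC P x.length k + t) from by rw [← e]]
    rw [branchW_cz _ ⟨k, hk⟩ hlt]
    by_cases hoff : IsCoinOff P x.length (nOf x.length) t
    · rcases hoff with ht | ⟨i, hi, b, hb, hte⟩
      · rw [zoneFn_lo _ ht]
        change liftW z (oC P x.length k + t) = z j
        rw [← e, liftW_val]
      · rw [hte, show kap P x.length + 1 + i * (4 * nOf x.length + 1) + b =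
          kap P x.length + 1 + ((⟨i, hi⟩ : Fin (nOf x.length)) : ℕ) * (4 * nOf x.length + 1) + ((⟨b, hb⟩ : Fin (4 * nOf x.length)) : ℕ) from rfl,
          zoneFn_digit]
        change liftW z (oC P x.length k + (kap P x.length + 1) + i * (4 * nOf x.length + 1) + b) = z j
        rw [show oC P x.length k + (kap P x.length + 1) + i * (4 * nOf x.length + 1) + b = j by omega, liftW_val]
    · rw [zoneFn_eq_false _ hoff, hpad, List.getD_eq_default _ _ (not_lt.1 h1)]
      intro hmem
      unfold coinPos at hmem
      rcases List.mem_append.1 hmem with hmem | hmem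
      · obtain ⟨k', hk', hp⟩ := List.mem_flatMap.1 hmem
        rw [List.mem_range] at hk'
        have hb := coinPosZone_bounds hp
        have hkk : k' = k := by
          by_contra hne
          rcases lt_or_gt_of_ne hne with hlt' | hlt'
          · have := oC_add_cW_le_oC (P := P) (L := x.length) hlt'; omega
          · have := oC_add_cW_le_oC (P := P) (L := x.length) hlt'; omega
        subst hkk
        rw [e] at hp
        exact hoff (mem_coinPosZone_iff_isCoinOff.1 hp)
      · obtain ⟨j', hj'r, hj'⟩ := List.mem_map.1 hmem
        rw [List.mem_range] at hj'r
        exact h2 ⟨by omega, by omega⟩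
  · rw [branchW_other _ (not_lt.1 h1) h2 h3, hpad, List.getD_eq_default _ _ (not_lt.1 h1)]
    intro hmem
    rcases coinWire_bounds hn (coinWire_of_mem_coinPos hmem) with hb | hb
    · exact h3 hb
    · exact h2 ⟨hb.1, by omega⟩

/-- `branchOf` is injective. [folklore] -/
theorem branchOf_injective (x : List Bool) : Function.Injective (branchOf P x) := fun c c' h => by
  apply branchW_injective (x := x) (nOf_le x.length)
  rw [← liftW_branchOf, ← liftW_branchOf, h]

/-- **Branches are exactly the assignments with coins.** [folklore] -/
theorem isBranch_iff_exists (z : QReg (x.length + anc P x.length)) : IsBranch P x z ↔ ∃ c, branchOf P x c = z :=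
  ⟨fun hz => ⟨_, branchOf_coinsOf hz⟩, fun ⟨c, hc⟩ => hc ▸ isBranch_branchOf c⟩

end HBranch

/-! ### Counting the coins -/

section Card

/-- The number of coin wires of one zone. [folklore] -/
theorem length_coinPosZone (L n k : ℕ) : (coinPosZone P L n k).length = (kap P L + 1) + n * (4 * n) := by
  unfold coinPosZone
  rw [List.length_append, List.length_map, List.length_range, List.length_flatMap]
  simp only [List.length_map, List.length_range, List.map_const', List.sum_replicate, smul_eq_mul]

/-- **The number of coins.** [folklore] -/
theorem numCoins_eq (L : ℕ) : numCoins P L = rmax P L * ((kap P L + 1) + nOf L * (4 * nOf L)) + gam P L := by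
  unfold numCoins coinPos
  rw [List.length_append, List.length_map, List.length_range, List.length_flatMap]
  simp only [length_coinPosZone, List.map_const', List.sum_replicate, List.length_range, smul_eq_mul]

/-- The number of zone patterns. [folklore] -/
theorem card_ZPat (L n : ℕ) : Fintype.card (ZPat P L n) = 2 ^ ((kap P L + 1) + n * (4 * n)) := by
  rw [Fintype.card_prod, Fintype.card_fun, Fintype.card_fun, Fintype.card_bool, Fintype.card_fin, Fintype.card_fin,
    Fintype.card_fun, Fintype.card_bool, Fintype.card_fin, ← pow_mul, ← pow_add]
  ring_nf

/-- **`|Coins| = 2^{numCoins}`.** [folklore] -/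
theorem card_Coins (L : ℕ) : Fintype.card (Coins P L (nOf L)) = 2 ^ numCoins P L := by
  rw [Fintype.card_prod, Fintype.card_fun, Fintype.card_bool, Fintype.card_fin, Fintype.card_fun, card_ZPat, Fintype.card_fin,
    ← pow_mul, ← pow_add, numCoins_eq]
  ring_nf

/-- The number of coin tuples with a fixed guess pattern. [folklore] -/
theorem card_zoneTuples (L : ℕ) : Fintype.card (Fin (rmax P L) → ZPat P L (nOf L)) * 2 ^ gam P L = 2 ^ numCoins P L := by
  rw [← card_Coins, Fintype.card_prod, Fintype.card_fun (α := Fin (gam P L)), Fintype.card_bool, Fintype.card_fin, mul_comm]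

end Card

/-! ### The state after the compiled program, through the coins -/

section StateQ

variable {x : List Bool}

/-- **`stateQ` is `2^{-numCoins/2}` on the image of `c ↦ kappa (branchOf c)` and `0` elsewhere.**
[cite: NielsenChuang2010, §1.4.4 (H^{⊗c}|0⟩ is uniform over the branches) and §3.2.5 (a reversible program permutes basis states)] -/
theorem stateQ_eq_coins (y : QReg (x.length + anc P x.length)) :
    stateQ P x y = if ∃ c, kappa P x.length (branchOf P x c) = y then invSqrt2 ^ numCoins P x.length else 0 := by
  classical
  set e := (kappaEmb P x.length).equivOfFiniteSelfEmbedding with he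
  have hy : kappa P x.length (e.symm y) = y := by
    change e (e.symm y) = y
    exact e.apply_symm_apply y
  rw [← hy, stateQ_kappa, stateH_eq]
  refine if_congr ⟨fun hb => ?_, ?_⟩ rfl rfl
  · exact ⟨_, congrArg (kappa P x.length) (branchOf_coinsOf hb)⟩
  · rintro ⟨c, hc⟩
    rw [← kappa_injective P x.length hc]
    exact isBranch_branchOf c

end StateQ

/-! ### The data of the final state, read off the coins -/

section ReadOff

variable {L n : ℕ} {x : List Bool} (c : Coins P L n)

/-- The guesses of the branch with coins `c`. [folklore] -/
theorem guessOf_branchW (t : Fin (gam P L)) : guessOf P L (branchW P L n x c) t = c.1 t := branchW_gz c t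

/-- The guesses agree with `gExt c.1` below `gam`. [folklore] -/
theorem guessOf_branchW_eq_gExt {t : ℕ} (ht : t < gam P L) : guessOf P L (branchW P L n x c) t = gExt P L c.1 t := by
  rw [gExt, dif_pos ht]; exact guessOf_branchW c ⟨t, ht⟩

/-- The `ix` coins of zone `k` of the branch with coins `c`. [folklore] -/
theorem ixcOf_branchW (k : Fin (rmax P L)) {t : ℕ} (ht : t < kap P L) : ixcOf P L (branchW P L n x c) k t = zoneFn P L n (c.2 k) t :=
  branchW_cz c k (by unfold cW sig slotW; omega)

/-- The `ta` coins of zone `k` of the branch with coins `c`. [folklore] -/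
theorem tacOf_branchW (k : Fin (rmax P L)) {t : ℕ} (ht : t < sig L) :
    tacOf P L (branchW P L n x c) k t = zoneFn P L n (c.2 k) (kap P L + t) :=
  branchW_cz c k (by unfold cW; omega)

end ReadOff


end RegevRoutine

end Literature.Algebra.EuclideanLattices

end
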